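import Summits.QuantumFields.YangMills.Theorems.BalabanUVNodesN11Sect3SupplyChainDefs
import Literature.MathematicalPhysics.QuantumFieldTheory.Balaban1983to89.B16RLeafRecord13LiveGenericZS

/-!
# DAG node N11 — THEOREM 1 OF [III] ALONG THE WITNESS CHAIN: every per-level deliverable keyed to THE CHAIN's witness (the suppliers' own constructed terms), not to
# «every exposed witness» — the witness-threaded form of the induction `SLaw_k → TLaw_k → SLaw_{k+1}` at a generic v1.7 parameter on the live-selector line

Cell `pub-ymgap`, YM-PLAN Track A (HUMAN RULING D-0062 ∕ D-0149), seat `pub-ymgap-dag-n11-e` (g15; R134 fan-out row N11∕s3), route `BalabanUVNodes` rev 25 (v1.7 `CoPH` key), item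
K1⁷ `StabilityBAtRecordR13SepCoPH` = stmt-QuantumFields-20542 (helper lane, count-neutral).  [III] = [Balaban1988Convergent], [IV] = [Balaban1989LargeFieldI].  Over this seat's
`…Sect3SupplyChainDefs` (`spliceTermsB ∕ spliceConst ∕ chainWitness ∕ NewEClausesAt ∕ PresentChildObligations ∕ NoExpansionClauseFor`), `…SpliceOwnBoundary`
(`lawsT_child_graftAboveB_of_rows`), `…Splice` (`lawsT_child_absent_of_newEClauses`), `…SpliceFrame`, `…StepReductionCoPH` (p552803 §0), `…TruncatedWitness` (p549689),
`…GeneralStepLawsCoPH` (p550088: the no-expansion child's frame IS the parent's), `…RePinnedUnivECoPH` §0 and `…B16RLeafRecord13LiveGenericZS` (this seat, g10: the CLAUSE-LEVEL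
live-line 𝐑-transfer `slotClauseΦ_succ_of_slotTClauseΦ_of_liveSel_of_rstep`, witness-agnostic).

WHY THIS FILE.  def-T's `SLaw₁₃CoPH θ p k` hides the §2 witness behind `∃`, so every supply predicate had to serve EVERY exposed witness — stronger than print, and exposed to
pathological witnesses (LOCATED-SPACEB's (O1); the old-term values inside `A_{k+1}`).  Here the witness is THREADED through the induction: `chainWitness θ p σ k` (Defs) is the
iterated deterministic splice of the suppliers' OWN responses, and Theorem 1 follows level by level with every deliverable stated FOR THE CHAIN's WITNESS ONLY:
§0 `newEClauses_of_newEClauses_of_eqE` (generic: the four 𝐄-clauses transfer between towers with the same `bgI` for term values with the same `𝐄^{(k+1)}`).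
§1 ★ `formAtZS_succ_of_formT_of_liveSel_of_rstep` — THE WITNESS-LEVEL 𝐑-STEP on the live-selector line: a 𝐓-image witness `(tT, EkT)` at level `k` IS a §2 witness of
   `ρ_{k+1}` (laws by 11c's `LawsT.toRT_succ`; the slot clause by the clause-level 𝐑-transfer — 𝐑 of record moves only dead sequences).
§2 ★★ `formT_spliceTermsB_of_rows` — THE WITNESS-LEVEL 𝐓-STEP: the deterministic splice of a level-`k` witness `(t, E_k)` with the supplier's response `(tnew, EkN)` IS a 𝐓-image
   witness at level `k`, given (OE) `NewEClausesAt` for `tnew`, `PresentChildObligations` at the 𝐓-present expansion children, and `NoExpansionClauseFor` for `(t, E_k)`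
   (`1 ≤ M`, `0 ≤ B₀`).
§3 ★★★ `formAtZS_chainWitness` — BY INDUCTION: `∀ k ≤ K`, the chain witness HAS the §2 form of `ρ_k`, from, AT EACH LEVEL `k < K`, the supplier's response to THE CHAIN's
   level-`k` witness meeting (OE) ∕ `PresentChildObligations`, and dag-n11-d's clause FOR THE CHAIN's witness; hence `sLaw₁₃CoPH_all_of_chain` = THEOREM 1 at `θ`, all
   levels, all histories — every deliverable about objects the suppliers built themselves.

HONEST FRAMING.  Count-neutral kernel bookkeeping; the per-level deliverables ([III] Sect. 1 ∕ §3 ∕ Thm 2 at the objects of record for the chain's witness; dag-n11-d's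
no-expansion clause) are DISPLAYED, not proved; nothing of Bałaban asserted; N11 NOT discharged; K1⁷ NOT closed; counts unmoved (typed 28∕28 · discharged 5∕27).  One finite
`𝕋⁴_{L^K}` programme at fixed `ε = L^{−K}`; NOT ℝ⁴, NOT OS, NOT a mass gap, NOT Clay.
Sources: [III] Theorem p.245, Thm 1 p.262, Thm 2 p.263, §2 p.262, §3 pp.264–265, (3.20) p.269, (3.24)–(3.25) p.270, §3 p.279, (2.17)–(2.18) p.257, (2.23)–(2.31) pp.258–260,
(2.34)–(2.42) p.261; [IV] (0.2)–(0.4) p.176, p.177 (i)–(ii); [Balaban1987RG1] (0.20) p.256.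
-/

noncomputable section

open MeasureTheory
open scoped BigOperators Matrix.Norms.L2Operator

namespace Summit.QuantumFields.YangMills.Theorems.BalabanUVNodesN11Sect3SupplyChain

open Literature.MathematicalPhysics.QuantumFieldTheory.Balaban1983to89 T4Continuum Node00 Node00.Tk DagBinding
open Step B14.Eq227LocalizedTerms
open Literature.MathematicalPhysics.QuantumFieldTheory.Balaban1983to89.B16RLeafRecord13LiveGenericZS (slotClauseΦ_succ_of_slotTClauseΦ_of_liveSel_of_rstep)
open BalabanUVNodesN11Sect3SupplySpliceDefs
open BalabanUVNodesN11Sect3SupplySpliceFrame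
open BalabanUVNodesN11Sect3SupplySplice (lawsT_child_absent_of_newEClauses)
open BalabanUVNodesN11Sect3SupplySpliceOwnBoundary (graftAboveB graftAboveB_E lawsT_child_graftAboveB_of_rows)
open BalabanUVNodesN11Sect3SupplyChainDefs
open BalabanUVNodesN11NoExpansionTruncatedWitness (sect2Slot_succ_congr_of_agree_of_Omega_empty)
open BalabanUVNodesN11NoExpansionGeneralStepLawsCoPH (sect2TowerOfRecord_rzAt_succ_eq_init_of_Omega_empty)
open BalabanUVNodesN11NoExpansionStepReductionCoPH (lawsT_towerOfTerms_of_lawsRT_of_agree_of_newE)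
open BalabanUVNodesN11NoExpansionStepReductionRePinnedUnivECoPH (towerOfTerms_space_eq_of_bgI_eq)

/-! ## §0  Generic: the four level-`(k+1)` 𝐄-clauses transfer along equal `𝐄^{(k+1)}` and equal `bgI` -/

section Transfer

variable {P : Params} {𝔸 : Type*} [NormedRing 𝔸] [NormedAlgebra ℂ 𝔸] [CompleteSpace 𝔸] {V : Type*} {M : ℕ} {G : Type*} [GaugeGroup G]

/-- **THE FOUR LEVEL-`(k+1)` 𝐄-CLAUSES TRANSFER** from term values `u` on a tower `(S, Rz, M, Ω)` to any `t′` with the same `𝐄^{(k+1)}` on any tower `(S, Rz′, M, Ω′)` with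
`Rz′.bgI = Rz.bgI` (the 𝐄-space reads `bgI` only, `towerOfTerms_space_eq_of_bgI_eq`; `agreeOn ∕ act ∕ 𝐃_{k+1}` are the setting's). [cite: Balaban1988Convergent, (2.25)–(2.28) p.259, §2 p.262 (bookkeeping)] -/
theorem newEClauses_of_newEClauses_of_eqE (S : Sect2.Setting 𝔸 G) {Rz Rz' : Sect2.Residual P 𝔸} (hbg : Rz'.bgI = Rz.bgI) (Ω Ω' : ℕ → Set (Site P 0)) {k : ℕ}
    {u t' : Sect2.TermValues P 𝔸 V M} (hE : ∀ X z g, t'.E (k + 1) X z g = u.E (k + 1) X z g)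
    (h : (∀ X z g φ ψ, (Sect2.towerOfTerms S Rz M Ω u).agreeOn (k + 1) X φ ψ → u.E (k + 1) X z g φ = u.E (k + 1) X z g ψ) ∧
      (∀ X z g v φ, u.E (k + 1) X z g ((Sect2.towerOfTerms S Rz M Ω u).act v φ) = u.E (k + 1) X z g φ) ∧
      (∀ X z g φ, 0 ≤ g → g ≤ S.lf.γ →
        φ ∈ (Sect2.towerOfTerms S Rz M Ω u).space (k + 1) X (S.lf.alpha0 (S.flow.g (k + 1))) (S.lf.alpha1 (S.flow.g (k + 1))) →
          ‖u.E (k + 1) X z g φ‖ ≤ S.lf.E₀ * Real.exp (-((1 + 4 * S.βc) * S.lf.κ) * (Sect2.domSys P M (k + 1)).dj X)) ∧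
      (∀ X z g, 0 ≤ g → g ≤ S.lf.γ →
        AnalyticOnNhd ℂ (u.E (k + 1) X z g) ((Sect2.towerOfTerms S Rz M Ω u).space (k + 1) X (S.lf.alpha0 (S.flow.g (k + 1))) (S.lf.alpha1 (S.flow.g (k + 1)))))) :
    (∀ X z g φ ψ, (Sect2.towerOfTerms S Rz' M Ω' t').agreeOn (k + 1) X φ ψ → t'.E (k + 1) X z g φ = t'.E (k + 1) X z g ψ) ∧
    (∀ X z g v φ, t'.E (k + 1) X z g ((Sect2.towerOfTerms S Rz' M Ω' t').act v φ) = t'.E (k + 1) X z g φ) ∧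
    (∀ X z g φ, 0 ≤ g → g ≤ S.lf.γ →
      φ ∈ (Sect2.towerOfTerms S Rz' M Ω' t').space (k + 1) X (S.lf.alpha0 (S.flow.g (k + 1))) (S.lf.alpha1 (S.flow.g (k + 1))) →
        ‖t'.E (k + 1) X z g φ‖ ≤ S.lf.E₀ * Real.exp (-((1 + 4 * S.βc) * S.lf.κ) * (Sect2.domSys P M (k + 1)).dj X)) ∧
    (∀ X z g, 0 ≤ g → g ≤ S.lf.γ →
      AnalyticOnNhd ℂ (t'.E (k + 1) X z g) ((Sect2.towerOfTerms S Rz' M Ω' t').space (k + 1) X (S.lf.alpha0 (S.flow.g (k + 1))) (S.lf.alpha1 (S.flow.g (k + 1))))) := by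
  obtain ⟨hloc, hinv, hbd, han⟩ := h
  have hsp : ∀ (X : (Sect2.domSys P M (k + 1)).Dom) (α₀ α₁ : ℝ),
      (Sect2.towerOfTerms S Rz' M Ω' t').space (k + 1) X α₀ α₁ = (Sect2.towerOfTerms S Rz M Ω u).space (k + 1) X α₀ α₁ :=
    fun X α₀ α₁ => towerOfTerms_space_eq_of_bgI_eq S hbg Ω Ω' u t' (k + 1) X α₀ α₁
  refine ⟨fun X z g φ ψ hφψ => ?_, fun X z g v φ => ?_, fun X z g φ hg0 hgγ hφ => ?_, fun X z g hg0 hgγ => ?_⟩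
  · rw [hE]; exact hloc X z g φ ψ hφψ
  · rw [hE]; exact hinv X z g v φ
  · rw [hE]; rw [hsp] at hφ; exact hbd X z g φ hg0 hgγ hφ
  · rw [hE, hsp]; exact han X z g hg0 hgγ

end Transfer

variable {F : T4Family} {N : ℕ} [NeZero N]
variable (θ : Stage13HParams F N) (p : B12.RunParams)

/-! ## §1  The witness-level 𝐑-step on the live-selector line -/

section RStep

/-- **★ THE WITNESS-LEVEL 𝐑-STEP ON THE LIVE-SELECTOR LINE**: a 𝐓-image witness `(tT, EkT)` of `𝐓ρ_k` at level `k` (laws `Sect2.LawsT … k` and the 𝐓-image clause at every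
history of length `k+1`) IS a §2 witness of `ρ_{k+1}` — the SAME term values and constants: the laws weaken to the inductive assumptions at `k+1` (11c's `LawsT.toRT_succ`,
signs `0 ≤ β, κ, E₀, B₀`, `0 ≤ g_{k+1}`), and 𝐑 of record (row `rstep` of `θ.Provisos₁₃CoPH`, K0a's live selector) moves only DEAD sequences and is the identity on live ones, so
the post-𝐑 slot is the pre-𝐑 slot a.e. on the χ-support or zero (this seat's clause-level `…LiveGenericZS.slotClauseΦ_succ_of_slotTClauseΦ_of_liveSel_of_rstep`).
[cite: Balaban1988Convergent, §2 p.262, Thm 2 p.263, (3.24)–(3.25) p.270; Balaban1989LargeFieldI, (0.2)–(0.4) p.176, p.177 (i)–(ii)] -/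
theorem formAtZS_succ_of_formT_of_liveSel_of_rstep (h : θ.Provisos₁₃CoPH F N)
    (hsel : θ.ppSel = ppSelLiveOfRecord F N θ.ν θ.τ9 (EOfRecord₁₃ F N θ.toStage13Params) (wOfRecord₉ F N θ.toStage9Params))
    (hθ : θ.Admissible F N) (hκ : 0 ≤ θ.s2.lf.κ) (hE₀ : 0 ≤ θ.s2.lf.E₀) (hB₀ : 0 ≤ θ.s2.lf.B₀) {k : ℕ} (hk : k < p.K)
    (tT : SeqOfRecord F θ.ν θ.τ9.M (gOfRecord₁₃ F N θ.toStage13Params p) p.K (k + 1) → Sect2.TermValues (F.P p.K) (MatA N) (FluctV N) θ.τ9.M) (EkT : SeqOfRecord F θ.ν θ.τ9.M (gOfRecord₁₃ F N θ.toStage13Params p) p.K (k + 1) → ℝ)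
    (hT : HasSect2FormAtZS F N (FluctV N) p.K (settingOfRecord₁₃ F N θ.toStage13Params p) (k + 1) (θ.rzAt p) (WtOfRecord₁₃H F N θ p) (UbgOfRecord₁₃CoP F N θ.toStage13Params p (k + 1))
      (fun s u => Sect2.LawsT (sect2TowerOfRecord F N (FluctV N) p.K (settingOfRecord₁₃ F N θ.toStage13Params p) (θ.rzAt p s) s u) (settingOfRecord₁₃ F N θ.toStage13Params p).lf (settingOfRecord₁₃ F N θ.toStage13Params p).βc k)
      (slotsTOfRecord F N θ.ν θ.τ9 (EOfRecord₁₃ F N θ.toStage13Params) (wOfRecord₉ F N θ.toStage9Params) θ.ppSel p (gOfRecord₁₃ F N θ.toStage13Params p) (k + 1)) tT EkT) :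
    HasSect2FormAtZS F N (FluctV N) p.K (settingOfRecord₁₃ F N θ.toStage13Params p) (k + 1) (θ.rzAt p) (WtOfRecord₁₃H F N θ p) (UbgOfRecord₁₃CoP F N θ.toStage13Params p (k + 1))
      (fun s u => Sect2.LawsRT (sect2TowerOfRecord F N (FluctV N) p.K (settingOfRecord₁₃ F N θ.toStage13Params p) (θ.rzAt p s) s u) (settingOfRecord₁₃ F N θ.toStage13Params p).lf (k + 1))
      (slotsOfRecord F N θ.ν θ.τ9 (EOfRecord₁₃ F N θ.toStage13Params) (wOfRecord₉ F N θ.toStage9Params) θ.ppSel p (gOfRecord₁₃ F N θ.toStage13Params p) (k + 1)) tT EkT := by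
  obtain ⟨hu, hs⟩ := hT
  refine ⟨hu, fun s => ⟨(hs s).1.toRT_succ hθ.toStage12.pos.2.1 hκ hE₀ hB₀ (B16RLeafRecord13Live.gOfRecord₁₃_succ_nonneg F N θ.toStage13Params p k), ?_⟩⟩
  exact slotClauseΦ_succ_of_slotTClauseΦ_of_liveSel_of_rstep F N θ.toStage13Params p (fun q j _ hj => h.rstep q j hj) hsel k hk s _ (fun _ => (hs s).2)

end RStep

/-! ## §2  The witness-level 𝐓-step: the deterministic splice is a 𝐓-image witness -/

section TStep

/-- **★★ THE DETERMINISTIC SPLICE IS A 𝐓-IMAGE WITNESS AT LEVEL `k`** (generic `θ`; `1 ≤ M`, `0 ≤ B₀`): from a §2 witness `(t, E_k)` of `ρ_k` and the supplier's response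
`(tnew, EkN)` (universal in 𝐄) with (OE) the four 𝐄-clauses for `tnew s′` at every `s′`, the obligations `PresentChildObligations` at every 𝐓-present expansion child, and
dag-n11-d's `NoExpansionClauseFor (t, E_k)`, the pair `(spliceTermsB θ p k t tnew, spliceConst θ p k E_k EkN)` has the laws `Sect2.LawsT … k` and the 𝐓-image clause at EVERY
history of length `k+1`: no-expansion histories by p550088 ∕ p552803 ∕ p549689 (the child's frame is the parent's; laws with the universal new 𝐄 and no new `𝐑 ∕ 𝐁`; the
clause does not read the witness above `k`), 𝐓-absent expansion children by `…Splice.lawsT_child_absent_of_newEClauses` and the zero disjunct, 𝐓-present ones by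
`…OwnBoundary.lawsT_child_graftAboveB_of_rows` and (O3′). [cite: Balaban1988Convergent, Theorem p.245, §2 p.262, §3 p.279, (3.24)–(3.25) p.270, (3.1) p.264, (2.25)–(2.31) pp.259–260, (2.40)–(2.42) p.261] -/
theorem formT_spliceTermsB_of_rows {k : ℕ} (hM : 1 ≤ θ.τ9.M) (hB₀ : 0 ≤ θ.s2.lf.B₀)
    (t : SeqOfRecord F θ.ν θ.τ9.M (gOfRecord₁₃ F N θ.toStage13Params p) p.K k → Sect2.TermValues (F.P p.K) (MatA N) (FluctV N) θ.τ9.M) (Ek : SeqOfRecord F θ.ν θ.τ9.M (gOfRecord₁₃ F N θ.toStage13Params p) p.K k → ℝ)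
    (hS : HasSect2FormAtZS F N (FluctV N) p.K (settingOfRecord₁₃ F N θ.toStage13Params p) k (θ.rzAt p) (WtOfRecord₁₃H F N θ p) (UbgOfRecord₁₃CoP F N θ.toStage13Params p k)
      (fun s u => Sect2.LawsRT (sect2TowerOfRecord F N (FluctV N) p.K (settingOfRecord₁₃ F N θ.toStage13Params p) (θ.rzAt p s) s u) (settingOfRecord₁₃ F N θ.toStage13Params p).lf k)
      (slotsOfRecord F N θ.ν θ.τ9 (EOfRecord₁₃ F N θ.toStage13Params) (wOfRecord₉ F N θ.toStage9Params) θ.ppSel p (gOfRecord₁₃ F N θ.toStage13Params p) k) t Ek)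
    (tnew : SeqOfRecord F θ.ν θ.τ9.M (gOfRecord₁₃ F N θ.toStage13Params p) p.K (k + 1) → Sect2.TermValues (F.P p.K) (MatA N) (FluctV N) θ.τ9.M) (EkN : SeqOfRecord F θ.ν θ.τ9.M (gOfRecord₁₃ F N θ.toStage13Params p) p.K (k + 1) → ℝ) (huN : Sect2.UniversalE tnew)
    (hOE : ∀ s : SeqOfRecord F θ.ν θ.τ9.M (gOfRecord₁₃ F N θ.toStage13Params p) p.K (k + 1), NewEClausesAt θ p k (tnew s) s)
    (hpres : ∀ s : SeqOfRecord F θ.ν θ.τ9.M (gOfRecord₁₃ F N θ.toStage13Params p) p.K (k + 1), s.Ω (k + 1) ≠ ∅ → slotsTOfRecord F N θ.ν θ.τ9 (EOfRecord₁₃ F N θ.toStage13Params) (wOfRecord₉ F N θ.toStage9Params) θ.ppSel p (gOfRecord₁₃ F N θ.toStage13Params p) (k + 1) s ≠ 0 → PresentChildObligations θ p k t tnew EkN s)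
    (hTcl : NoExpansionClauseFor θ p k t Ek) :
    HasSect2FormAtZS F N (FluctV N) p.K (settingOfRecord₁₃ F N θ.toStage13Params p) (k + 1) (θ.rzAt p) (WtOfRecord₁₃H F N θ p) (UbgOfRecord₁₃CoP F N θ.toStage13Params p (k + 1))
      (fun s u => Sect2.LawsT (sect2TowerOfRecord F N (FluctV N) p.K (settingOfRecord₁₃ F N θ.toStage13Params p) (θ.rzAt p s) s u) (settingOfRecord₁₃ F N θ.toStage13Params p).lf (settingOfRecord₁₃ F N θ.toStage13Params p).βc k)
      (slotsTOfRecord F N θ.ν θ.τ9 (EOfRecord₁₃ F N θ.toStage13Params) (wOfRecord₉ F N θ.toStage9Params) θ.ppSel p (gOfRecord₁₃ F N θ.toStage13Params p) (k + 1)) (spliceTermsB θ p k t tnew) (spliceConst θ p k Ek EkN) := by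
  classical
  obtain ⟨hu, hs⟩ := hS
  have hrg := settingOfRecord₁₃_satisfiesRG F N θ.toStage13Params p (k + 1) k (Nat.lt_succ_self k)
  have hg := B16RLeafRecord13Live.gOfRecord₁₃_succ_nonneg F N θ.toStage13Params p k
  -- the four 𝐄-clauses for any term values whose `𝐄^{(k+1)}` is `(tnew s)`'s, on the child's tower
  have hEcl : ∀ (s : SeqOfRecord F θ.ν θ.τ9.M (gOfRecord₁₃ F N θ.toStage13Params p) p.K (k + 1)) (t' : Sect2.TermValues (F.P p.K) (MatA N) (FluctV N) θ.τ9.M), (∀ X z g, t'.E (k + 1) X z g = (tnew s).E (k + 1) X z g) →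
      (∀ X z g φ ψ, (sect2TowerOfRecord F N (FluctV N) p.K (settingOfRecord₁₃ F N θ.toStage13Params p) (θ.rzAt p s) s t').agreeOn (k + 1) X φ ψ → t'.E (k + 1) X z g φ = t'.E (k + 1) X z g ψ) ∧
      (∀ X z g v φ, t'.E (k + 1) X z g ((sect2TowerOfRecord F N (FluctV N) p.K (settingOfRecord₁₃ F N θ.toStage13Params p) (θ.rzAt p s) s t').act v φ) = t'.E (k + 1) X z g φ) ∧
      (∀ X z g φ, 0 ≤ g → g ≤ (settingOfRecord₁₃ F N θ.toStage13Params p).lf.γ →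
        φ ∈ (sect2TowerOfRecord F N (FluctV N) p.K (settingOfRecord₁₃ F N θ.toStage13Params p) (θ.rzAt p s) s t').space (k + 1) X ((settingOfRecord₁₃ F N θ.toStage13Params p).lf.alpha0 ((settingOfRecord₁₃ F N θ.toStage13Params p).flow.g (k + 1))) ((settingOfRecord₁₃ F N θ.toStage13Params p).lf.alpha1 ((settingOfRecord₁₃ F N θ.toStage13Params p).flow.g (k + 1))) →
          ‖t'.E (k + 1) X z g φ‖ ≤ (settingOfRecord₁₃ F N θ.toStage13Params p).lf.E₀ * Real.exp (-((1 + 4 * (settingOfRecord₁₃ F N θ.toStage13Params p).βc) * (settingOfRecord₁₃ F N θ.toStage13Params p).lf.κ) * (Sect2.domSys (F.P p.K) θ.τ9.M (k + 1)).dj X)) ∧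
      (∀ X z g, 0 ≤ g → g ≤ (settingOfRecord₁₃ F N θ.toStage13Params p).lf.γ →
        AnalyticOnNhd ℂ (t'.E (k + 1) X z g)
          ((sect2TowerOfRecord F N (FluctV N) p.K (settingOfRecord₁₃ F N θ.toStage13Params p) (θ.rzAt p s) s t').space (k + 1) X ((settingOfRecord₁₃ F N θ.toStage13Params p).lf.alpha0 ((settingOfRecord₁₃ F N θ.toStage13Params p).flow.g (k + 1))) ((settingOfRecord₁₃ F N θ.toStage13Params p).lf.alpha1 ((settingOfRecord₁₃ F N θ.toStage13Params p).flow.g (k + 1))))) :=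
    fun s t' hE' => newEClauses_of_newEClauses_of_eqE (settingOfRecord₁₃ F N θ.toStage13Params p) (Rz := θ.rzAt p s) (Rz' := θ.rzAt p s) rfl s.Ω s.Ω hE' (hOE s)
  refine ⟨universalE_spliceTermsB hu huN, fun s => ?_⟩
  by_cases hΩ : s.Ω (k + 1) = ∅
  · -- no-expansion history: old terms, universal new 𝐄, no new 𝐑 ∕ 𝐁, constant `E_k(init s′)`; the child's frame IS the parent's
    rw [spliceTermsB_of_Omega_empty t tnew s hΩ, spliceConst_of_Omega_empty Ek EkN s hΩ]
    have hlaw : Sect2.LawsRT (sect2TowerOfRecord F N (FluctV N) p.K (settingOfRecord₁₃ F N θ.toStage13Params p) (θ.rzAt p s) s (t s.init)) (settingOfRecord₁₃ F N θ.toStage13Params p).lf k := by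
      rw [sect2TowerOfRecord_rzAt_succ_eq_init_of_Omega_empty θ p s hΩ (t s.init)]; exact (hs s.init).1
    have hE : ∀ j, j ≤ k → ∀ X z g φ, (graftAbove k (t s.init) (zeroRB (tnew s))).E j X z g φ = (t s.init).E j X z g φ :=
      fun j hj X z g φ => graftAbove_E_of_le _ _ hj X z g φ
    have hR : ∀ j, j ≤ k → ∀ X φ, (graftAbove k (t s.init) (zeroRB (tnew s))).R j X φ = (t s.init).R j X φ :=
      fun j hj X φ => graftAbove_R_of_le _ _ hj X φ
    have hB : ∀ j, j ≤ k → ∀ X φ a, (graftAbove k (t s.init) (zeroRB (tnew s))).B j X φ a = (t s.init).B j X φ a :=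
      fun j hj X φ a => graftAbove_B_of_le _ _ hj X φ a
    obtain ⟨hloc, hinv, hbd, han⟩ := hEcl s (graftAbove k (t s.init) (zeroRB (tnew s))) (fun X z g => graftAbove_E_succ k _ _ X z g)
    refine ⟨lawsT_towerOfTerms_of_lawsRT_of_agree_of_newE _ _ _ hE hR hB
      (fun X φ => by rw [graftAbove_R_of_lt _ _ (Nat.lt_succ_self k)]; rfl) (fun X φ a => by rw [graftAbove_B_of_lt _ _ (Nat.lt_succ_self k)]; rfl)
      hloc hinv hbd han hlaw hrg hB₀ hg, ?_⟩
    rw [sect2Slot_succ_congr_of_agree_of_Omega_empty (FluctV N) _ _ _ hM s hΩ hE hR hB]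
    exact hTcl s hΩ
  · by_cases h0 : slotsTOfRecord F N θ.ν θ.τ9 (EOfRecord₁₃ F N θ.toStage13Params) (wOfRecord₉ F N θ.toStage9Params) θ.ppSel p (gOfRecord₁₃ F N θ.toStage13Params p) (k + 1) s = 0
    · -- 𝐓-absent expansion child: old `𝐁^{(k)}` and new `𝐑 ∕ 𝐁` zeroed; laws by bookkeeping, clause by the zero disjunct
      rw [spliceTermsB_of_absent t tnew s hΩ h0]
      refine ⟨lawsT_child_absent_of_newEClauses θ p hB₀ s (hs s.init).1 ?_, Or.inl h0⟩
      exact hEcl s _ (fun X z g => graftAbove_E_succ k _ _ X z g)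
    · -- 𝐓-present expansion child: the supplier's obligations
      rw [spliceTermsB_of_present t tnew s hΩ h0, spliceConst_of_Omega_ne Ek EkN s hΩ]
      obtain ⟨hO1, hO2, hanE, hanR, hanB, hO3⟩ := hpres s hΩ h0
      exact ⟨lawsT_child_graftAboveB_of_rows θ p s (hs s.init).1 hO1 hO2 hanE hanR hanB, hO3⟩

end TStep

/-! ## §3  Theorem 1 along the witness chain -/

section Chain

/-- **★★★ THE CHAIN WITNESS HAS THE §2 FORM OF `ρ_k` AT EVERY LEVEL `k ≤ K`** — Theorem 1 of [III] at a generic v1.7 parameter `θ` on the live-selector line, WITNESS-THREADED: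
by induction on `k`, the base being def-T's level-0 witness (`baseWitness_form`), the step §2 (the splice of the chain's level-`k` witness with the supplier's response is a
𝐓-image witness) followed by §1 (the 𝐑-step keeps the witness).  HYPOTHESES, per level `k < K`, FOR THE CHAIN's level-`k` WITNESS ONLY, and each MAY ASSUME that witness's §2 form at `k` (the
inductive hypothesis — print's §3 uses the inductive assumptions on the old terms): (OE) the four 𝐄-clauses for the
supplier's response; `PresentChildObligations` at the 𝐓-present expansion children ((O1′) the supplier's `𝐁^{(k)}`, (O2) Thm 2's clauses, (O3′) the 𝐓-image identity);
dag-n11-d's `NoExpansionClauseFor`.  Besides: core provisos (row `rstep`), the selector clause, admissibility, `0 ≤ κ, E₀, B₀`, `1 ≤ M`.  Every deliverable concerns objects the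
suppliers built themselves — print's induction. [cite: Balaban1988Convergent, Thm 1 p.262, Theorem p.245, Thm 2 p.263, §3 p.279, (3.24)–(3.25) p.270; Balaban1989LargeFieldI, (0.2)–(0.4) p.176, p.177 (i)–(ii)] -/
theorem formAtZS_chainWitness (h : θ.Provisos₁₃CoPH F N)
    (hsel : θ.ppSel = ppSelLiveOfRecord F N θ.ν θ.τ9 (EOfRecord₁₃ F N θ.toStage13Params) (wOfRecord₉ F N θ.toStage9Params))
    (hθ : θ.Admissible F N) (hκ : 0 ≤ θ.s2.lf.κ) (hE₀ : 0 ≤ θ.s2.lf.E₀) (hB₀ : 0 ≤ θ.s2.lf.B₀) (hM : 1 ≤ θ.τ9.M) (σ : Sect3Supplier θ p)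
    (huN : ∀ k, k < p.K → HasSect2FormAtZS F N (FluctV N) p.K (settingOfRecord₁₃ F N θ.toStage13Params p) k (θ.rzAt p) (WtOfRecord₁₃H F N θ p) (UbgOfRecord₁₃CoP F N θ.toStage13Params p k)
        (fun s u => Sect2.LawsRT (sect2TowerOfRecord F N (FluctV N) p.K (settingOfRecord₁₃ F N θ.toStage13Params p) (θ.rzAt p s) s u) (settingOfRecord₁₃ F N θ.toStage13Params p).lf k)
        (slotsOfRecord F N θ.ν θ.τ9 (EOfRecord₁₃ F N θ.toStage13Params) (wOfRecord₉ F N θ.toStage9Params) θ.ppSel p (gOfRecord₁₃ F N θ.toStage13Params p) k) (chainWitness θ p σ k).1 (chainWitness θ p σ k).2 →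
      Sect2.UniversalE (σ k (chainWitness θ p σ k).1 (chainWitness θ p σ k).2).1)
    (hOE : ∀ k, k < p.K → HasSect2FormAtZS F N (FluctV N) p.K (settingOfRecord₁₃ F N θ.toStage13Params p) k (θ.rzAt p) (WtOfRecord₁₃H F N θ p) (UbgOfRecord₁₃CoP F N θ.toStage13Params p k)
        (fun s u => Sect2.LawsRT (sect2TowerOfRecord F N (FluctV N) p.K (settingOfRecord₁₃ F N θ.toStage13Params p) (θ.rzAt p s) s u) (settingOfRecord₁₃ F N θ.toStage13Params p).lf k)
        (slotsOfRecord F N θ.ν θ.τ9 (EOfRecord₁₃ F N θ.toStage13Params) (wOfRecord₉ F N θ.toStage9Params) θ.ppSel p (gOfRecord₁₃ F N θ.toStage13Params p) k) (chainWitness θ p σ k).1 (chainWitness θ p σ k).2 →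
      ∀ s : SeqOfRecord F θ.ν θ.τ9.M (gOfRecord₁₃ F N θ.toStage13Params p) p.K (k + 1), NewEClausesAt θ p k ((σ k (chainWitness θ p σ k).1 (chainWitness θ p σ k).2).1 s) s)
    (hpres : ∀ k, k < p.K → HasSect2FormAtZS F N (FluctV N) p.K (settingOfRecord₁₃ F N θ.toStage13Params p) k (θ.rzAt p) (WtOfRecord₁₃H F N θ p) (UbgOfRecord₁₃CoP F N θ.toStage13Params p k)
        (fun s u => Sect2.LawsRT (sect2TowerOfRecord F N (FluctV N) p.K (settingOfRecord₁₃ F N θ.toStage13Params p) (θ.rzAt p s) s u) (settingOfRecord₁₃ F N θ.toStage13Params p).lf k)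
        (slotsOfRecord F N θ.ν θ.τ9 (EOfRecord₁₃ F N θ.toStage13Params) (wOfRecord₉ F N θ.toStage9Params) θ.ppSel p (gOfRecord₁₃ F N θ.toStage13Params p) k) (chainWitness θ p σ k).1 (chainWitness θ p σ k).2 →
      ∀ s : SeqOfRecord F θ.ν θ.τ9.M (gOfRecord₁₃ F N θ.toStage13Params p) p.K (k + 1), s.Ω (k + 1) ≠ ∅ → slotsTOfRecord F N θ.ν θ.τ9 (EOfRecord₁₃ F N θ.toStage13Params) (wOfRecord₉ F N θ.toStage9Params) θ.ppSel p (gOfRecord₁₃ F N θ.toStage13Params p) (k + 1) s ≠ 0 →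
      PresentChildObligations θ p k (chainWitness θ p σ k).1 (σ k (chainWitness θ p σ k).1 (chainWitness θ p σ k).2).1
        (σ k (chainWitness θ p σ k).1 (chainWitness θ p σ k).2).2 s)
    (hTcl : ∀ k, k < p.K → HasSect2FormAtZS F N (FluctV N) p.K (settingOfRecord₁₃ F N θ.toStage13Params p) k (θ.rzAt p) (WtOfRecord₁₃H F N θ p) (UbgOfRecord₁₃CoP F N θ.toStage13Params p k)
        (fun s u => Sect2.LawsRT (sect2TowerOfRecord F N (FluctV N) p.K (settingOfRecord₁₃ F N θ.toStage13Params p) (θ.rzAt p s) s u) (settingOfRecord₁₃ F N θ.toStage13Params p).lf k)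
        (slotsOfRecord F N θ.ν θ.τ9 (EOfRecord₁₃ F N θ.toStage13Params) (wOfRecord₉ F N θ.toStage9Params) θ.ppSel p (gOfRecord₁₃ F N θ.toStage13Params p) k) (chainWitness θ p σ k).1 (chainWitness θ p σ k).2 →
      NoExpansionClauseFor θ p k (chainWitness θ p σ k).1 (chainWitness θ p σ k).2) :
    ∀ k, k ≤ p.K → HasSect2FormAtZS F N (FluctV N) p.K (settingOfRecord₁₃ F N θ.toStage13Params p) k (θ.rzAt p) (WtOfRecord₁₃H F N θ p) (UbgOfRecord₁₃CoP F N θ.toStage13Params p k)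
      (fun s u => Sect2.LawsRT (sect2TowerOfRecord F N (FluctV N) p.K (settingOfRecord₁₃ F N θ.toStage13Params p) (θ.rzAt p s) s u) (settingOfRecord₁₃ F N θ.toStage13Params p).lf k)
      (slotsOfRecord F N θ.ν θ.τ9 (EOfRecord₁₃ F N θ.toStage13Params) (wOfRecord₉ F N θ.toStage9Params) θ.ppSel p (gOfRecord₁₃ F N θ.toStage13Params p) k) (chainWitness θ p σ k).1 (chainWitness θ p σ k).2 := by
  intro k
  induction k with
  | zero => exact fun _ => baseWitness_form θ p
  | succ k ih =>
    intro hk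
    have hk' : k < p.K := Nat.lt_of_succ_le hk
    exact formAtZS_succ_of_formT_of_liveSel_of_rstep θ p h hsel hθ hκ hE₀ hB₀ hk' _ _
      (formT_spliceTermsB_of_rows θ p hM hB₀ _ _ (ih hk'.le) _ _ (huN k hk' (ih hk'.le)) (hOE k hk' (ih hk'.le)) (hpres k hk' (ih hk'.le))
        (hTcl k hk' (ih hk'.le)))

/-- **★★★ … HENCE THEOREM 1 OF [III] AT `θ`, ALL LEVELS, ALL HISTORIES — `∀ k ≤ K, SLaw₁₃CoPH θ p k` — FROM A WITNESS-KEYED SUPPLY CHAIN** (def-T's `sLaw₁₃CoPH_iff`).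
[cite: Balaban1988Convergent, Thm 1 p.262, Theorem p.245; Balaban1989LargeFieldI, (0.2)–(0.4) p.176] -/
theorem sLaw₁₃CoPH_all_of_chain (h : θ.Provisos₁₃CoPH F N)
    (hsel : θ.ppSel = ppSelLiveOfRecord F N θ.ν θ.τ9 (EOfRecord₁₃ F N θ.toStage13Params) (wOfRecord₉ F N θ.toStage9Params))
    (hθ : θ.Admissible F N) (hκ : 0 ≤ θ.s2.lf.κ) (hE₀ : 0 ≤ θ.s2.lf.E₀) (hB₀ : 0 ≤ θ.s2.lf.B₀) (hM : 1 ≤ θ.τ9.M) (σ : Sect3Supplier θ p)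
    (huN : ∀ k, k < p.K → HasSect2FormAtZS F N (FluctV N) p.K (settingOfRecord₁₃ F N θ.toStage13Params p) k (θ.rzAt p) (WtOfRecord₁₃H F N θ p) (UbgOfRecord₁₃CoP F N θ.toStage13Params p k)
        (fun s u => Sect2.LawsRT (sect2TowerOfRecord F N (FluctV N) p.K (settingOfRecord₁₃ F N θ.toStage13Params p) (θ.rzAt p s) s u) (settingOfRecord₁₃ F N θ.toStage13Params p).lf k)
        (slotsOfRecord F N θ.ν θ.τ9 (EOfRecord₁₃ F N θ.toStage13Params) (wOfRecord₉ F N θ.toStage9Params) θ.ppSel p (gOfRecord₁₃ F N θ.toStage13Params p) k) (chainWitness θ p σ k).1 (chainWitness θ p σ k).2 →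
      Sect2.UniversalE (σ k (chainWitness θ p σ k).1 (chainWitness θ p σ k).2).1)
    (hOE : ∀ k, k < p.K → HasSect2FormAtZS F N (FluctV N) p.K (settingOfRecord₁₃ F N θ.toStage13Params p) k (θ.rzAt p) (WtOfRecord₁₃H F N θ p) (UbgOfRecord₁₃CoP F N θ.toStage13Params p k)
        (fun s u => Sect2.LawsRT (sect2TowerOfRecord F N (FluctV N) p.K (settingOfRecord₁₃ F N θ.toStage13Params p) (θ.rzAt p s) s u) (settingOfRecord₁₃ F N θ.toStage13Params p).lf k)
        (slotsOfRecord F N θ.ν θ.τ9 (EOfRecord₁₃ F N θ.toStage13Params) (wOfRecord₉ F N θ.toStage9Params) θ.ppSel p (gOfRecord₁₃ F N θ.toStage13Params p) k) (chainWitness θ p σ k).1 (chainWitness θ p σ k).2 →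
      ∀ s : SeqOfRecord F θ.ν θ.τ9.M (gOfRecord₁₃ F N θ.toStage13Params p) p.K (k + 1), NewEClausesAt θ p k ((σ k (chainWitness θ p σ k).1 (chainWitness θ p σ k).2).1 s) s)
    (hpres : ∀ k, k < p.K → HasSect2FormAtZS F N (FluctV N) p.K (settingOfRecord₁₃ F N θ.toStage13Params p) k (θ.rzAt p) (WtOfRecord₁₃H F N θ p) (UbgOfRecord₁₃CoP F N θ.toStage13Params p k)
        (fun s u => Sect2.LawsRT (sect2TowerOfRecord F N (FluctV N) p.K (settingOfRecord₁₃ F N θ.toStage13Params p) (θ.rzAt p s) s u) (settingOfRecord₁₃ F N θ.toStage13Params p).lf k)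
        (slotsOfRecord F N θ.ν θ.τ9 (EOfRecord₁₃ F N θ.toStage13Params) (wOfRecord₉ F N θ.toStage9Params) θ.ppSel p (gOfRecord₁₃ F N θ.toStage13Params p) k) (chainWitness θ p σ k).1 (chainWitness θ p σ k).2 →
      ∀ s : SeqOfRecord F θ.ν θ.τ9.M (gOfRecord₁₃ F N θ.toStage13Params p) p.K (k + 1), s.Ω (k + 1) ≠ ∅ → slotsTOfRecord F N θ.ν θ.τ9 (EOfRecord₁₃ F N θ.toStage13Params) (wOfRecord₉ F N θ.toStage9Params) θ.ppSel p (gOfRecord₁₃ F N θ.toStage13Params p) (k + 1) s ≠ 0 →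
      PresentChildObligations θ p k (chainWitness θ p σ k).1 (σ k (chainWitness θ p σ k).1 (chainWitness θ p σ k).2).1
        (σ k (chainWitness θ p σ k).1 (chainWitness θ p σ k).2).2 s)
    (hTcl : ∀ k, k < p.K → HasSect2FormAtZS F N (FluctV N) p.K (settingOfRecord₁₃ F N θ.toStage13Params p) k (θ.rzAt p) (WtOfRecord₁₃H F N θ p) (UbgOfRecord₁₃CoP F N θ.toStage13Params p k)
        (fun s u => Sect2.LawsRT (sect2TowerOfRecord F N (FluctV N) p.K (settingOfRecord₁₃ F N θ.toStage13Params p) (θ.rzAt p s) s u) (settingOfRecord₁₃ F N θ.toStage13Params p).lf k)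
        (slotsOfRecord F N θ.ν θ.τ9 (EOfRecord₁₃ F N θ.toStage13Params) (wOfRecord₉ F N θ.toStage9Params) θ.ppSel p (gOfRecord₁₃ F N θ.toStage13Params p) k) (chainWitness θ p σ k).1 (chainWitness θ p σ k).2 →
      NoExpansionClauseFor θ p k (chainWitness θ p σ k).1 (chainWitness θ p σ k).2) :
    ∀ k, k ≤ p.K → SLaw₁₃CoPH F N θ p k := fun k hk =>
  (sLaw₁₃CoPH_iff F N θ p k).mpr ⟨_, _, formAtZS_chainWitness θ p h hsel hθ hκ hE₀ hB₀ hM σ huN hOE hpres hTcl k hk⟩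

end Chain

end Summit.QuantumFields.YangMills.Theorems.BalabanUVNodesN11Sect3SupplyChain

end
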